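import Literature.Analysis.FluidPDE.KNSSLiouvilleGalileanFrame
import HarnessLib

/-!
# Viscosity normalisation of bounded weak solutions; KNSS's Liouville theorems for every `ν > 0`

Analysis/FluidPDE consequences file (all results proved, no definitions, no named facts).
Koch–Nadirashvili–Seregin–Šverák normalise the viscosity to one ("We can assume `ν = 1`
without loss of generality", Acta Math. 203 (2009) = arXiv:0709.3599, §1) and the tree's
statements of their Theorems 5.2–5.3 for the bounded weak class
(`KNSS2009_liouville_axisymmetric_no_swirl`, `KNSS2009_liouville_bound_C_over_r`, both DISCHARGED,
`KNSSThm53OfWindow`; the Galilean-frame form `KNSS2009_liouville_bound_C_over_r_galilean`,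
`KNSSLiouvilleGalileanFrame`) carry `ν = 1`. The normalisation is the time/amplitude rescaling
`u ↦ a u(a t, ·)`, which maps solutions with viscosity `ν` to solutions with viscosity `a ν` (with
`a = ν⁻¹`: to unit viscosity); the tree has it for the mild and Kato classes
(`Fluid.IsMildNSSolutionFrom.timeRescale`, `KatoViscosityScaling`) but not for KNSS's bounded
weak class. This file proves

* `IsBoundedWeakNSSolutionOn.timeRescale` (any finite-dimensional `E`): if `u` is a bounded weak
  solution on the open time set `I` with viscosity `ν`, then `(t, x) ↦ a u(a t, x)` is a bounded
  weak solution with viscosity `a ν` on any open `J` with `t ∈ J ↔ a t ∈ I` (`a > 0`);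
* the `ν > 0` forms of Theorem 5.2 (`KNSS2009_liouville_axisymmetric_no_swirl_viscosity`),
  Theorem 5.3 (`KNSS2009_liouville_bound_C_over_r_viscosity`) and of Theorem 5.3 in a Galilean
  frame (`KNSS2009_liouville_bound_C_over_r_galilean_viscosity`) on `ℝ³ × (−∞, 0)`.

WHAT THIS IS NOT: no statement about Navier–Stokes regularity or blow-up; a change of units.

## Proof of the rescaling

Test `w(t, x) = a u(a t, x)` against `ψ` (a test field on the slab `J × E`) and substitute
`s = a t`: `∫_J ∫ (⟪w, ∂ₜψ⟫ + ⟪w, (w·∇)ψ⟫ + aν⟪w, Δψ⟫) dt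
= ∫_I ∫ (⟪u, (∂ₜψ)(s/a)⟫ + a⟪u, (u·∇)ψ(s/a)⟫ + aν⟪u, Δψ(s/a)⟫) ds`, which is the weak identity
for `u` tested against `φ(s, x) = a ψ(s/a, x)` — a test field on `I × E` with divergence-free
slices, `∂ₛφ = (∂ₜψ)(s/a)`, `Dφ = a Dψ(s/a)`, `Δφ = aΔψ(s/a)`. No integral is split: only the
one-dimensional change of variables `∫ H(a t) dt = a⁻¹ ∫ H` (Mathlib
`Measure.integral_comp_mul_left`) and `∫ a F = a ∫ F` are used. Measurability and the bound move
along the quasi-measure-preserving map `(t, x) ↦ (a t, x)` (`quasiMeasurePreserving_stAffine`),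
the divergence constraint along `t ↦ a t` and `v ↦ a v`.

## Mathlib / tree search

Tree: `IsBoundedWeakNSSolutionOn` and the `ν = 1` facts above; `stPull`/`stAffine` calculus
(`SpaceTimeRescaling`: `timeDeriv_stPull`, `fderiv_stPull`, `laplacian_stPull`,
`divergence_stPull`, `IsSpaceTimeTestOn.stPull`, `map_stAffine_volume_restrict_preimage`,
`quasiMeasurePreserving_time_affine`); no weak-class viscosity scaling
(`rg 'IsBoundedWeakNSSolutionOn' | rg 'rescale|visc'`: none). Mathlib:
`Measure.integral_comp_mul_left`, `integral_indicator`, `Set.indicator_comp_right`,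
`InnerProductSpace.laplacian_smul`, `fderiv_const_smul`, `HasDerivAt.const_smul`.

## References

* G. Koch, N. Nadirashvili, G. Seregin, V. Šverák, *Liouville theorems for the Navier–Stokes
  equations and applications*, Acta Math. 203 (2009) 83–105 = arXiv:0709.3599, §1 (`ν = 1`
  w.l.o.g.; scaling symmetry `u(x,t) ↦ λu(λx, λ²t)`), §4 (ii) p. 8, Thm 5.2 (pp. 9–10), Thm 5.3
  (p. 10). [KochNadirashviliSereginSverak2009]
* T. Kato, *Strong `L^p`-solutions of the Navier–Stokes equation in `ℝ^m`*, Math. Z. 187 (1984),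
  §1 (scaling of solutions). [Kato1984]
-/

noncomputable section

open MeasureTheory Set Function Filter Topology TopologicalSpace InnerProductSpace Measure
open scoped RealInnerProductSpace Laplacian ContDiff

namespace Literature.Analysis.FluidPDE

section Rescale

variable {E : Type*} [NormedAddCommGroup E] [InnerProductSpace ℝ E] [FiniteDimensional ℝ E]
  [MeasurableSpace E] [BorelSpace E]

/-- A scalar multiple of a weakly divergence-free field is weakly divergence free
(`∫ ⟪a v, ∇θ⟫ = a ∫ ⟪v, ∇θ⟫`, no integrability needed). [folklore] -/
private theorem IsWeaklyDivFree.const_smul_aux {v : E → E} (hv : IsWeaklyDivFree v) (a : ℝ) :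
    IsWeaklyDivFree (fun x => a • v x) := by
  intro θ hθ
  simp_rw [inner_smul_left, RCLike.conj_to_real]
  rw [MeasureTheory.integral_const_mul, hv θ hθ, mul_zero]

/-- A.e.-in-time statements on `J` transport to `I` along `t ↦ a t` (`a > 0`, `t ∈ J ↔ a t ∈ I`).
[folklore] -/
private theorem ae_restrict_comp_mul_left_aux {I J : Set ℝ} (hI : MeasurableSet I)
    (hJ : MeasurableSet J) {a : ℝ} (ha : 0 < a) (hIJ : ∀ t, t ∈ J ↔ a * t ∈ I) {P : ℝ → Prop}
    (h : ∀ᵐ s ∂(volume.restrict I), P s) : ∀ᵐ t ∂(volume.restrict J), P (a * t) := by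
  rw [ae_restrict_iff' hI] at h
  rw [ae_restrict_iff' hJ]
  have h2 := (quasiMeasurePreserving_time_affine ha 0).ae h
  filter_upwards [h2] with t ht htJ
  simp only [zero_add] at ht
  exact ht ((hIJ t).1 htJ)

/-- **Viscosity/time rescaling of bounded weak Navier–Stokes solutions** (KNSS 2009, §1: `ν = 1`
without loss of generality; Kato 1984, §1): if `u` is a bounded weak solution on the open time
set `I` with viscosity `ν`, and `a > 0`, then `(t, x) ↦ a u(a t, x)` is a bounded weak solution
with viscosity `a ν` on every open time set `J` with `t ∈ J ↔ a t ∈ I`. [cite: KochNadirashviliSereginSverak2009, §1 (ν = 1 w.l.o.g.) with §4 (ii) p. 8; Kato1984 §1] -/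
theorem IsBoundedWeakNSSolutionOn.timeRescale {I : Set ℝ} {hI : IsOpen I} {ν : ℝ}
    {u : ℝ → E → E} (h : IsBoundedWeakNSSolutionOn I hI ν u) {a : ℝ} (ha : 0 < a)
    {J : Set ℝ} {hJ : IsOpen J} (hIJ : ∀ t, t ∈ J ↔ a * t ∈ I) :
    IsBoundedWeakNSSolutionOn J hJ (a * ν) (fun t x => a • u (a * t) x) := by
  obtain ⟨hmeas, ⟨C, hC⟩, hdiv, hweak⟩ := h
  have hpre : stAffine a 1 0 0 ⁻¹' (I ×ˢ (univ : Set E)) = J ×ˢ univ := by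
    ext p
    simp [stAffine, hIJ]
  refine ⟨?_, ⟨a * C, fun t ht x => ?_⟩, ?_, fun ψ hψ hψdiv => ?_⟩
  · -- measurability, along the quasi-measure-preserving `(t, x) ↦ (a t, x)`
    have hq : QuasiMeasurePreserving (stAffine a 1 0 (0 : E))
        ((volume : Measure (ℝ × E)).restrict (J ×ˢ univ))
        ((volume : Measure (ℝ × E)).restrict (I ×ˢ univ)) := by
      refine ⟨measurable_stAffine a 1 0 0, ?_⟩
      rw [← hpre, map_stAffine_volume_restrict_preimage ha one_pos]
      exact Measure.smul_absolutelyContinuous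
    have heq : uncurry (fun t x => a • u (a * t) x) =
        (fun w : E => a • w) ∘ uncurry u ∘ stAffine a 1 0 (0 : E) := by
      funext p
      obtain ⟨t, x⟩ := p
      simp [stAffine_apply]
    rw [heq]
    exact (continuous_const_smul a).comp_aestronglyMeasurable (hmeas.comp_quasiMeasurePreserving hq)
  · -- the bound
    rw [norm_smul, Real.norm_eq_abs, abs_of_pos ha]
    exact mul_le_mul_of_nonneg_left (hC _ ((hIJ t).1 ht) x) ha.le
  · -- the divergence constraint
    have h1 := ae_restrict_comp_mul_left_aux hI.measurableSet hJ.measurableSet ha hIJ hdiv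
    filter_upwards [h1] with t ht
    exact ht.const_smul_aux a
  · -- the weak identity: test `u` against `φ(s, x) = a ψ(s/a, x)`
    set φ₀ : ℝ → E → E := stPull a⁻¹ 1 0 0 ψ with hφ₀def
    have hφ₀eq : ∀ s x, φ₀ s x = ψ (a⁻¹ * s) x := fun s x => by
      simp [hφ₀def, stPull_apply]
    have hpreJ : stPreimage a⁻¹ 1 0 (0 : E) (slab E J hJ) = slab E I hI := by
      ext p
      rw [SetLike.mem_coe, SetLike.mem_coe, mem_stPreimage, mem_slab, mem_slab, stAffine_fst,
        hIJ, zero_add, mul_inv_cancel_left₀ ha.ne']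
    have hφ₀ : IsSpaceTimeTestOn (slab E I hI) φ₀ := by
      have := hψ.stPull (inv_ne_zero ha.ne') one_ne_zero 0 (0 : E)
      rwa [hpreJ] at this
    set φ : ℝ → E → E := fun s x => a • φ₀ s x with hφdef
    have hφ : IsSpaceTimeTestOn (slab E I hI) φ := by
      have e : uncurry φ = fun p => a • uncurry φ₀ p := by
        funext p
        obtain ⟨s, x⟩ := p
        rfl
      refine ⟨?_, ?_, ?_⟩
      · rw [e]
        exact contDiff_const.smul hφ₀.contDiff
      · rw [e]
        exact hφ₀.hasCompactSupport.smul_left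
      · rw [e]
        exact (tsupport_smul_subset_right (fun _ : ℝ × E => a) (uncurry φ₀)).trans
          hφ₀.tsupport_subset
    -- the calculus of `φ`
    have htd₀ : ∀ s x, timeDeriv φ₀ s x = a⁻¹ • timeDeriv ψ (a⁻¹ * s) x := fun s x => by
      rw [hφ₀def, timeDeriv_stPull]
      simp
    have hfd₀ : ∀ s x, fderiv ℝ (φ₀ s) x = fderiv ℝ (ψ (a⁻¹ * s)) x := fun s x => by
      rw [hφ₀def, fderiv_stPull]
      simp
    have hlap₀ : ∀ s x, (Δ (φ₀ s)) x = (Δ (ψ (a⁻¹ * s))) x := fun s x => by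
      have h2 : ContDiff ℝ 2 (ψ (0 + a⁻¹ * s)) := hψ.contDiff_slice_two _
      rw [hφ₀def, laplacian_stPull a⁻¹ 1 0 (0 : E) ψ s x h2]
      simp
    have htd : ∀ s x, timeDeriv φ s x = timeDeriv ψ (a⁻¹ * s) x := fun s x => by
      have h1 : HasDerivAt (fun s => φ s x) (a • timeDeriv φ₀ s x) s :=
        (hφ₀.hasDerivAt_time s x).const_smul a
      rw [timeDeriv_apply, h1.deriv, htd₀, smul_smul, mul_inv_cancel₀ ha.ne', one_smul]
    have hfd : ∀ s x, fderiv ℝ (φ s) x = a • fderiv ℝ (ψ (a⁻¹ * s)) x := fun s x => by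
      have hd : DifferentiableAt ℝ (φ₀ s) x := (hφ₀.contDiff_slice s).differentiable (by simp) x
      rw [show φ s = fun x => a • φ₀ s x from rfl, fderiv_fun_const_smul hd a, hfd₀]
    have hlap : ∀ s x, (Δ (φ s)) x = a • (Δ (ψ (a⁻¹ * s))) x := fun s x => by
      have hd : ContDiffAt ℝ 2 (φ₀ s) x := (hφ₀.contDiff_slice_two s).contDiffAt
      rw [show φ s = a • φ₀ s from rfl, laplacian_smul a hd, hlap₀]
    have hφdiv : ∀ s, VectorCalculus.IsDivFree (φ s) := by
      intro s x
      have hd : DifferentiableAt ℝ (φ₀ s) x := (hφ₀.contDiff_slice s).differentiable (by simp) x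
      rw [show φ s = fun x => a • φ₀ s x from rfl, divergence_const_smul_apply hd,
        show φ₀ s = stPull a⁻¹ 1 0 (0 : E) ψ s from rfl, divergence_stPull, one_mul]
      rw [hψdiv _ _, mul_zero]
    have key := hweak φ hφ hφdiv
    -- the inner integral of the identity for `u` against `φ`, as a function of `s = a t`
    set G : ℝ → ℝ := fun s => ∫ x, (⟪u s x, timeDeriv ψ (a⁻¹ * s) x⟫ +
      a * ⟪u s x, fderiv ℝ (ψ (a⁻¹ * s)) x (u s x)⟫ +
      a * ν * ⟪u s x, (Δ (ψ (a⁻¹ * s))) x⟫) with hGdef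
    have key' : ∫ s in I, G s = 0 := by
      rw [← key]
      refine setIntegral_congr_fun hI.measurableSet fun s _ => ?_
      simp only [hGdef]
      refine integral_congr_ae (Eventually.of_forall fun x => ?_)
      simp only [convect_apply, htd, hfd, hlap, _root_.smul_apply, inner_smul_right]
      ring
    -- change of variables `s = a t` in the time integral
    have hcov : ∫ t in J, G (a * t) = a⁻¹ * ∫ s in I, G s := by
      rw [← integral_indicator hJ.measurableSet, ← integral_indicator hI.measurableSet]
      have hind : (J.indicator fun t => G (a * t)) = fun t => I.indicator G (a * t) := by
        funext t
        by_cases ht : t ∈ J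
        · rw [indicator_of_mem ht, indicator_of_mem ((hIJ t).1 ht)]
        · rw [indicator_of_notMem ht, indicator_of_notMem (fun h => ht ((hIJ t).2 h))]
      rw [hind, Measure.integral_comp_mul_left (fun s => I.indicator G s) a,
        abs_of_pos (inv_pos.2 ha), smul_eq_mul]
    -- the slices of the rescaled field
    have hG : ∀ t, (∫ x, (⟪a • u (a * t) x, timeDeriv ψ t x⟫ +
        ⟪a • u (a * t) x, fderiv ℝ (ψ t) x (a • u (a * t) x)⟫ +
        a * ν * ⟪a • u (a * t) x, (Δ (ψ t)) x⟫)) = a * G (a * t) := by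
      intro t
      simp only [hGdef, inv_mul_cancel_left₀ ha.ne']
      rw [← MeasureTheory.integral_const_mul]
      refine integral_congr_ae (Eventually.of_forall fun x => ?_)
      simp only [inner_smul_left, map_smul, inner_smul_right, RCLike.conj_to_real]
      ring
    simp only [convect_apply]
    calc ∫ t in J, ∫ x, (⟪a • u (a * t) x, timeDeriv ψ t x⟫ +
          ⟪a • u (a * t) x, fderiv ℝ (ψ t) x (a • u (a * t) x)⟫ +
          a * ν * ⟪a • u (a * t) x, (Δ (ψ t)) x⟫)
        = ∫ t in J, a * G (a * t) := setIntegral_congr_fun hJ.measurableSet fun t _ => hG t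
      _ = a * ∫ t in J, G (a * t) := MeasureTheory.integral_const_mul _ _
      _ = 0 := by rw [hcov, key', mul_zero, mul_zero]

/-- The unit-viscosity normalisation on `(−∞, 0)`: `(t, x) ↦ ν⁻¹ u(ν⁻¹ t, x)` is a bounded weak
solution with viscosity `1` when `u` is one with viscosity `ν > 0` (KNSS 2009, §1). [cite: KochNadirashviliSereginSverak2009, §1 (ν = 1 w.l.o.g.) with §4 (ii) p. 8] -/
theorem IsBoundedWeakNSSolutionOn.timeRescale_Iio_one {ν : ℝ} (hν : 0 < ν) {u : ℝ → E → E}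
    (h : IsBoundedWeakNSSolutionOn (Iio 0) isOpen_Iio ν u) :
    IsBoundedWeakNSSolutionOn (Iio 0) isOpen_Iio 1 (fun t x => ν⁻¹ • u (ν⁻¹ * t) x) := by
  have h1 := h.timeRescale (inv_pos.2 hν) (J := Iio 0) (hJ := isOpen_Iio) fun t => by
    rw [mem_Iio, mem_Iio]
    constructor
    · intro ht
      exact mul_neg_of_pos_of_neg (inv_pos.2 hν) ht
    · intro ht
      by_contra hle
      push Not at hle
      exact absurd ht (not_lt.2 (mul_nonneg (inv_pos.2 hν).le hle))
  rwa [inv_mul_cancel₀ hν.ne'] at h1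

end Rescale

/-! ### The Liouville theorems 5.2 and 5.3 for every viscosity `ν > 0` -/

section R3

/-- Rotations about the axis commute with scalars. [folklore] -/
private theorem rotZ_smul_aux (θ a : ℝ) (y : EuclideanSpace ℝ (Fin 3)) :
    rotZ θ (a • y) = a • rotZ θ y := by
  ext i
  fin_cases i <;> simp [rotZ] <;> ring

/-- The swirl of a scalar multiple. [folklore] -/
private theorem swirl_smul_aux (a : ℝ) (v : EuclideanSpace ℝ (Fin 3) → EuclideanSpace ℝ (Fin 3))
    (x : EuclideanSpace ℝ (Fin 3)) : swirl (fun y => a • v y) x = a * swirl v x := by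
  simp [swirl]
  ring

/-- A.e.-in-time statements on `(−∞, 0)` transport along `t ↦ a t`, `a > 0`. [folklore] -/
private theorem ae_restrict_Iio_comp_mul_left_aux {a : ℝ} (ha : 0 < a) {P : ℝ → Prop}
    (h : ∀ᵐ s ∂(volume.restrict (Iio (0 : ℝ))), P s) :
    ∀ᵐ t ∂(volume.restrict (Iio (0 : ℝ))), P (a * t) := by
  rw [ae_restrict_iff' measurableSet_Iio] at h ⊢
  have h2 := (quasiMeasurePreserving_time_affine ha 0).ae h
  filter_upwards [h2] with t ht ht0
  simp only [zero_add] at ht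
  exact ht (mul_neg_of_pos_of_neg ha ht0)

variable {ν : ℝ} {u : ℝ → EuclideanSpace ℝ (Fin 3) → EuclideanSpace ℝ (Fin 3)}

/-- The a.e. axisymmetry hypothesis passes to the normalised field. [folklore] -/
private theorem ae_rotZ_rescale_aux (hν : 0 < ν)
    (hax : ∀ θ : ℝ, ∀ᵐ t ∂(volume.restrict (Iio (0 : ℝ))),
      (fun x => u t (rotZ θ x)) =ᵐ[volume] fun x => rotZ θ (u t x)) (θ : ℝ) :
    ∀ᵐ t ∂(volume.restrict (Iio (0 : ℝ))),
      (fun x => ν⁻¹ • u (ν⁻¹ * t) (rotZ θ x)) =ᵐ[volume] fun x => rotZ θ (ν⁻¹ • u (ν⁻¹ * t) x) := by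
  filter_upwards [ae_restrict_Iio_comp_mul_left_aux (inv_pos.2 hν) (hax θ)] with t ht
  filter_upwards [ht] with x hx
  rw [hx, rotZ_smul_aux]

/-- **KNSS 2009, Theorem 5.3, every viscosity `ν > 0`.** A bounded weak solution of Navier–Stokes
with viscosity `ν > 0` on `ℝ³ × (−∞, 0)`, axisymmetric (a.e. form), with `r ‖u‖ ≤ C` a.e., is a.e.
zero on a.e. slice (normalise `ν = 1` by `u ↦ ν⁻¹ u(ν⁻¹ t, ·)`, which preserves axisymmetry and
multiplies the bound by `ν⁻¹`; then `KNSS2009_liouville_bound_C_over_r_holds`). [cite: KochNadirashviliSereginSverak2009, Thm 5.3 (arXiv p. 10) with §1 (ν = 1 w.l.o.g.)] -/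
theorem KNSS2009_liouville_bound_C_over_r_viscosity (hν : 0 < ν)
    (hu : IsBoundedWeakNSSolutionOn (Iio 0) isOpen_Iio ν u)
    (hax : ∀ θ : ℝ, ∀ᵐ t ∂(volume.restrict (Iio (0 : ℝ))),
      (fun x => u t (rotZ θ x)) =ᵐ[volume] fun x => rotZ θ (u t x))
    (hC : ∃ C : ℝ, ∀ᵐ t ∂(volume.restrict (Iio (0 : ℝ))),
      ∀ᵐ x ∂(volume : Measure (EuclideanSpace ℝ (Fin 3))), cylRadius x * ‖u t x‖ ≤ C) :
    ∀ᵐ t ∂(volume.restrict (Iio (0 : ℝ))), u t =ᵐ[volume] 0 := by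
  have hw := hu.timeRescale_Iio_one hν
  have hC' : ∃ C : ℝ, ∀ᵐ t ∂(volume.restrict (Iio (0 : ℝ))),
      ∀ᵐ x ∂(volume : Measure (EuclideanSpace ℝ (Fin 3))),
        cylRadius x * ‖ν⁻¹ • u (ν⁻¹ * t) x‖ ≤ C := by
    obtain ⟨C, hC⟩ := hC
    refine ⟨ν⁻¹ * C, ?_⟩
    filter_upwards [ae_restrict_Iio_comp_mul_left_aux (inv_pos.2 hν) hC] with t ht
    filter_upwards [ht] with x hx
    rw [norm_smul, Real.norm_eq_abs, abs_of_pos (inv_pos.2 hν), mul_left_comm]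
    exact mul_le_mul_of_nonneg_left hx (inv_pos.2 hν).le
  have h53 := KNSS2009_liouville_bound_C_over_r_holds hw (ae_rotZ_rescale_aux hν hax) hC'
  -- back along `t ↦ ν t`
  have h1 := ae_restrict_Iio_comp_mul_left_aux hν h53
  filter_upwards [h1] with t ht
  filter_upwards [ht] with x hx
  simp only [inv_mul_cancel_left₀ hν.ne', Pi.zero_apply, smul_eq_zero, inv_eq_zero,
    hν.ne', false_or] at hx
  exact hx

/-- **KNSS 2009, Theorem 5.2, every viscosity `ν > 0`.** A bounded weak solution with viscosity
`ν > 0` on `ℝ³ × (−∞, 0)`, axisymmetric with no swirl (a.e. forms), is a.e. on a.e. slice an axial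
constant `b(t) e_z` with `b` bounded and measurable (normalise `ν = 1`, apply
`KNSS2009_liouville_axisymmetric_no_swirl_holds`, and scale back: `b(t) = ν b₁(ν t)`). [cite: KochNadirashviliSereginSverak2009, Thm 5.2 (arXiv pp. 9–10) with §1 (ν = 1 w.l.o.g.)] -/
theorem KNSS2009_liouville_axisymmetric_no_swirl_viscosity (hν : 0 < ν)
    (hu : IsBoundedWeakNSSolutionOn (Iio 0) isOpen_Iio ν u)
    (hax : ∀ θ : ℝ, ∀ᵐ t ∂(volume.restrict (Iio (0 : ℝ))),
      (fun x => u t (rotZ θ x)) =ᵐ[volume] fun x => rotZ θ (u t x))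
    (hswirl : ∀ᵐ t ∂(volume.restrict (Iio (0 : ℝ))),
      swirl (u t) =ᵐ[volume] (0 : EuclideanSpace ℝ (Fin 3) → ℝ)) :
    ∃ b : ℝ → ℝ, Measurable b ∧ (∃ C : ℝ, ∀ t, |b t| ≤ C) ∧
      ∀ᵐ t ∂(volume.restrict (Iio (0 : ℝ))), u t =ᵐ[volume] fun _ => b t • eZ := by
  have hw := hu.timeRescale_Iio_one hν
  have hswirl' : ∀ᵐ t ∂(volume.restrict (Iio (0 : ℝ))),
      swirl (fun x => ν⁻¹ • u (ν⁻¹ * t) x) =ᵐ[volume] (0 : EuclideanSpace ℝ (Fin 3) → ℝ) := by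
    filter_upwards [ae_restrict_Iio_comp_mul_left_aux (inv_pos.2 hν) hswirl] with t ht
    filter_upwards [ht] with x hx
    rw [swirl_smul_aux, hx, Pi.zero_apply, mul_zero]
  obtain ⟨b₁, hb₁m, ⟨C, hC⟩, hb₁⟩ :=
    KNSS2009_liouville_axisymmetric_no_swirl_holds hw (ae_rotZ_rescale_aux hν hax) hswirl'
  refine ⟨fun t => ν * b₁ (ν * t), (measurable_const.mul (hb₁m.comp (measurable_const_mul ν))),
    ⟨ν * C, fun t => ?_⟩, ?_⟩
  · rw [abs_mul, abs_of_pos hν]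
    exact mul_le_mul_of_nonneg_left (hC _) hν.le
  · have h1 := ae_restrict_Iio_comp_mul_left_aux hν hb₁
    filter_upwards [h1] with t ht
    filter_upwards [ht] with x hx
    simp only [inv_mul_cancel_left₀ hν.ne'] at hx
    -- `hx : ν⁻¹ • u t x = b₁ (ν * t) • eZ`
    have h2 := congrArg (fun v : EuclideanSpace ℝ (Fin 3) => ν • v) hx
    simp only [smul_smul, mul_inv_cancel₀ hν.ne', one_smul] at h2
    exact h2

/-- **KNSS 2009, Theorem 5.3 in a Galilean frame, every viscosity `ν > 0`**: a bounded weak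
solution with viscosity `ν > 0` on `ℝ³ × (−∞, 0)`, axisymmetric, with `r ‖u − c e_z‖ ≤ C` a.e., is
a.e. the constant `c e_z` on a.e. slice (normalise `ν = 1`: the bound becomes
`r ‖ν⁻¹u − (c/ν) e_z‖ ≤ C/ν`; `KNSS2009_liouville_bound_C_over_r_galilean`). [cite: KochNadirashviliSereginSverak2009, Thm 5.3 (arXiv p. 10) with §1; MajdaBertozziCUP2002 §1.2 Prop. 1.1 (i)] -/
theorem KNSS2009_liouville_bound_C_over_r_galilean_viscosity (hν : 0 < ν)
    (hu : IsBoundedWeakNSSolutionOn (Iio 0) isOpen_Iio ν u)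
    (hax : ∀ θ : ℝ, ∀ᵐ t ∂(volume.restrict (Iio (0 : ℝ))),
      (fun x => u t (rotZ θ x)) =ᵐ[volume] fun x => rotZ θ (u t x))
    (c : ℝ) (hC : ∃ C : ℝ, ∀ᵐ t ∂(volume.restrict (Iio (0 : ℝ))),
      ∀ᵐ x ∂(volume : Measure (EuclideanSpace ℝ (Fin 3))), cylRadius x * ‖u t x - c • eZ‖ ≤ C) :
    ∀ᵐ t ∂(volume.restrict (Iio (0 : ℝ))), u t =ᵐ[volume] fun _ => c • eZ := by
  have hw := hu.timeRescale_Iio_one hν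
  have hC' : ∃ C : ℝ, ∀ᵐ t ∂(volume.restrict (Iio (0 : ℝ))),
      ∀ᵐ x ∂(volume : Measure (EuclideanSpace ℝ (Fin 3))),
        cylRadius x * ‖ν⁻¹ • u (ν⁻¹ * t) x - (ν⁻¹ * c) • eZ‖ ≤ C := by
    obtain ⟨C, hC⟩ := hC
    refine ⟨ν⁻¹ * C, ?_⟩
    filter_upwards [ae_restrict_Iio_comp_mul_left_aux (inv_pos.2 hν) hC] with t ht
    filter_upwards [ht] with x hx
    rw [← smul_smul, ← smul_sub, norm_smul, Real.norm_eq_abs, abs_of_pos (inv_pos.2 hν),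
      mul_left_comm]
    exact mul_le_mul_of_nonneg_left hx (inv_pos.2 hν).le
  have h53 := KNSS2009_liouville_bound_C_over_r_galilean hw (ae_rotZ_rescale_aux hν hax) (ν⁻¹ * c) hC'
  have h1 := ae_restrict_Iio_comp_mul_left_aux hν h53
  filter_upwards [h1] with t ht
  filter_upwards [ht] with x hx
  simp only [inv_mul_cancel_left₀ hν.ne'] at hx
  have h2 := congrArg (fun v : EuclideanSpace ℝ (Fin 3) => ν • v) hx
  simp only [smul_smul, mul_inv_cancel₀ hν.ne', one_smul, mul_inv_cancel_left₀ hν.ne'] at h2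
  exact h2

end R3

end Literature.Analysis.FluidPDE

end
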